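/-
Copyright (c) 2026. All rights reserved.
Released under Apache 2.0 license as described in the file LICENSE.
-/
import Literature.Probability.FitznerVanDerHofstad2017.NobleBlocksPointwisePrime
import HarnessLib

/-!
# Fitzner–van der Hofstad (2017), §6.1 (6.4) / §5.1 (5.4) / App. B: the per-junction TARGET FAMILY of the regular class pairs

[FvdH17] = R. Fitzner, R. van der Hofstad, *Mean-field behavior for nearest-neighbor percolation in `d > 10`*,
arXiv:1506.07977v2 (EJP 22 (2017), paper 43).  Page numbers refer to the arXiv version.

The chain theorem `NobleBoundsNGrouped.prod_bondJ_mul_piPerc_jwCover_le_chain_of_packages` wants, for every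
middle junction `i` with regular classes `a_i = a₀`, `a_{i+1} = a′`, a TARGET FAMILY `tgt κ i : Bool × Fin 3 → ℝ≥0∞`
over the variants `v = ((τ i).1, (τ i).2)` (lower-level kind bit, inner class of the sausage pair) with
`Σ_v tgt κ i v ≤ B_pt'^{κ,a₀,a′}(u,w,t,z,w′,u′)` (hypothesis `hT`; times `P^{S,a₀}(u_0,w_0)` at `i = 0`).  The natural
family is the list of SUMMANDS of the pointwise primed middle block (5.4)
`blockBFullpt' 𝐋 X = Σ_c A'^{κ,a₀,c,*}(u,w,t,z)·A^{c,a′}(t,z,w′,u′) + δ_{z,t}·A'^{κ,a₀,a′}(u,w,w′,t)·P^{0}(u′−t,u′−t)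
+ B^{(2)}_pt(u,w,t,z,w′,u′) + X`, the `B^{(2)}` piece split by the inner class of the sausage pair `(t,z)` read on
the upper level: `c = 1` ↦ the App. B diagrams whose internal line `t — z` is a BOND (the summands carrying
`2dD(z − t)`, App. B Table p. 76 columns "d_{C̃}(w,u) = 1"), `c = 2` ↦ the others ("d_{C̃}(w,u) ≥ 2").

* §A. The two summand families `blockBNTpt₀'₁` / `blockBNTpt₀'₂` of `NobleBlocksNTPrime.blockBNTpt₀'` and their
  translates `blockBNTpt'₁` / `blockBNTpt'₂`; `blockBNTpt₀'_eq_add`, `blockBNTpt'_eq_add`; row literals.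
* §B. `tgtReg 𝐋 κ a₀ a′ u w t z w′ u′ : Bool × Fin 3 → ℝ≥0∞` and the SUM IDENTITY
  `sum_tgtReg_eq : Σ_v tgtReg … v = Σ_c T1(c) + T2 + B^{(2)}_pt` whence `Σ_v tgtReg … v ≤ blockBFullpt' 𝐋 X …`
  for every extra-summand slot `X` (`sum_tgtReg_le_blockBFullpt'`), also over any sub-family of variants and
  with the first-junction prefix `P^{S,a₀}(u_0,w_0)` (`sum_filter_tgtReg_le_blockBFullpt'`,
  `sum_filter_blockPS_mul_tgtReg_le`).

These are exactly the targets of the landed cell packages (`NobleBoundsNMidS*`, `…MidF1`, `…MidECut`,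
`…MidEProper[TZ]` and their first-junction copies): e.g. `tgtReg … (true, 1)` at `(a₀,a′) = (2,2)` is the target of
`NobleBoundsNMidEProperTZ.nonempty_jPkg_midE_properTZ_two_two_lit` (`tgtReg_true_one_two_two`).

Conventions: `d`-generic; nothing is cited as a fact; additive (no existing declaration is changed); nothing
about the extra summand `X` (packet question D77) is decided here — it is a parameter.
-/

noncomputable section

open scoped ENNReal

namespace Literature.Probability.FitznerVanDerHofstad2017.NobleBlocks

open Literature.Probability.LatticeModels Literature.Probability.Percolation
open scoped BigOperators ENNReal

variable {d : ℕ}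

/-! ### A. The two summand families of the base-`u` table `B^{(2)}` -/

/-- **The `c = 1` summands of `blockBNTpt₀'`** (the App. B diagrams in which the internal line `t — z` is a bond:
the terms carrying `2dD(z − t)`), row by row; rows `b ≤ 1` vanish.
[cite: FitznerVanDerHofstad2017, App. B Table "Diagrams and definition of B^{(2),ι,a,b}(0,v,x,y)", columns d_{C̃}(w,u) = 1 (arXiv:1506.07977v2 p. 76)] -/
def blockBNTpt₀'₁ (L : Letters d) (ι : Fin d × Bool) (a b : Fin 3) (v x y t z : Site d) : ℝ≥0∞ :=
  let e : Site d := stepVec ι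
  match a.val, b.val with
  | _, 0 => 0
  | _, 1 => 0
  | 0, _ => kd v 0 * (kdc v z *
            (L.p⁻¹ * twoDD (z - t) * L.T (.ge 1) (.ge 1) (.eq 1) (y - t) (z - t) 0 *
                L.P (.eq 1) (.ge 0) (.ge 1) (.eq 1) (.ge 1) e x t z 0))
  | 1, _ => L.p⁻¹ * twoDD v * twoDD (z - t) * L.T (.ge 1) (.ge 1) (.eq 1) (y - t) (z - t) 0 *
                L.P (.eq 1) (.ge 0) (.ge 1) (.eq 1) (.ge 0) e x t z v
  | _, _ => L.p⁻¹ * twoDD (z - t) * L.T (.ge 1) (.ge 1) (.eq 1) (y - t) (z - t) 0 *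
                L.P (.eq 1) (.ge 0) (.ge 1) (.eq 1) (.ge 0) e x t z v

/-- **The `c = 2` summands of `blockBNTpt₀'`** (the App. B diagrams in which the internal line `t — z` has
length `≥ 2`), row by row; rows `b ≤ 1` vanish.
[cite: FitznerVanDerHofstad2017, App. B Table "Diagrams and definition of B^{(2),ι,a,b}(0,v,x,y)", columns d_{C̃}(w,u) ≥ 2 (arXiv:1506.07977v2 p. 76)] -/
def blockBNTpt₀'₂ (L : Letters d) (ι : Fin d × Bool) (a b : Fin 3) (v x y t z : Site d) : ℝ≥0∞ :=
  let e : Site d := stepVec ι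
  match a.val, b.val with
  | _, 0 => 0
  | _, 1 => 0
  | 0, _ => kd v 0 * (kdc v z *
            (L.S (.ge 1) (.ge 0) (.eq 1) (.ge 1) (x - t) (e - t) (-t) (z - t) *
                L.T (.ge 2) (.ge 1) (.ge 1) (z - t) (y - t) 0))
  | 1, _ => L.p⁻¹ * L.T (.ge 1) (.ge 1) (.ge 2) (y - t) (z - t) 0 *
                L.P (.ge 1) (.ge 0) (.eq 1) (.eq 1) (.ge 0) (x - t) (e - t) (-t) (v - t) (z - t)
  | _, _ => L.B (.ge 1) (.ge 1) (y - t) (z - t) * L.P (.eq 1) (.ge 0) (.ge 1) (.ge 2) (.ge 0) e x t z v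

section Algebra

variable (L : Letters d) (ι : Fin d × Bool)

/-- **The base-`u` table is the sum of its two summand families.**
[cite: FitznerVanDerHofstad2017, App. B Table "Diagrams and definition of B^{(2),ι,a,b}(0,v,x,y)" (arXiv:1506.07977v2 p. 76)] -/
theorem blockBNTpt₀'_eq_add (a b : Fin 3) (v x y t z : Site d) :
    blockBNTpt₀' L ι a b v x y t z = blockBNTpt₀'₁ L ι a b v x y t z + blockBNTpt₀'₂ L ι a b v x y t z := by
  rcases a with ⟨_ | _ | _ | n, ha⟩ <;> rcases b with ⟨_ | _ | _ | m, hb⟩ <;>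
    first
    | (exfalso; omega)
    | (simp only [blockBNTpt₀', blockBNTpt₀'₁, blockBNTpt₀'₂, add_zero, mul_add])

/-- Row `a ≥ 2, b ≥ 2`, `c = 1` summand. [cite: FitznerVanDerHofstad2017, App. B Table "B^{(2),ι,a,b}", last row, d_{C̃}(w,u) = 1 (arXiv:1506.07977v2 p. 76)] -/
theorem blockBNTpt₀'₁_two_two (v x y t z : Site d) :
    blockBNTpt₀'₁ L ι 2 2 v x y t z =
      L.p⁻¹ * twoDD (z - t) * L.T (.ge 1) (.ge 1) (.eq 1) (y - t) (z - t) 0 *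
        L.P (.eq 1) (.ge 0) (.ge 1) (.eq 1) (.ge 0) (stepVec ι) x t z v := rfl

/-- Row `a ≥ 2, b ≥ 2`, `c = 2` summand. [cite: FitznerVanDerHofstad2017, App. B Table "B^{(2),ι,a,b}", last row, d_{C̃}(w,u) ≥ 2 (arXiv:1506.07977v2 p. 76)] -/
theorem blockBNTpt₀'₂_two_two (v x y t z : Site d) :
    blockBNTpt₀'₂ L ι 2 2 v x y t z =
      L.B (.ge 1) (.ge 1) (y - t) (z - t) * L.P (.eq 1) (.ge 0) (.ge 1) (.ge 2) (.ge 0) (stepVec ι) x t z v := rfl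

/-- Row `a = 1, b ≥ 2`, `c = 1` summand. [cite: FitznerVanDerHofstad2017, App. B Table "B^{(2),ι,a,b}", row a = 1, b ≥ 2, d_{C̃}(w,u) = 1 (arXiv:1506.07977v2 p. 76)] -/
theorem blockBNTpt₀'₁_one_two (v x y t z : Site d) :
    blockBNTpt₀'₁ L ι 1 2 v x y t z =
      L.p⁻¹ * twoDD v * twoDD (z - t) * L.T (.ge 1) (.ge 1) (.eq 1) (y - t) (z - t) 0 *
        L.P (.eq 1) (.ge 0) (.ge 1) (.eq 1) (.ge 0) (stepVec ι) x t z v := rfl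

/-- Row `a = 1, b ≥ 2`, `c = 2` summand. [cite: FitznerVanDerHofstad2017, App. B Table "B^{(2),ι,a,b}", row a = 1, b ≥ 2, d_{C̃}(w,u) ≥ 2 (arXiv:1506.07977v2 p. 76)] -/
theorem blockBNTpt₀'₂_one_two (v x y t z : Site d) :
    blockBNTpt₀'₂ L ι 1 2 v x y t z =
      L.p⁻¹ * L.T (.ge 1) (.ge 1) (.ge 2) (y - t) (z - t) 0 *
        L.P (.ge 1) (.ge 0) (.eq 1) (.eq 1) (.ge 0) (x - t) (stepVec ι - t) (-t) (v - t) (z - t) := rfl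

/-- Row `a = 0, b ≥ 2`, `c = 1` summand. [cite: FitznerVanDerHofstad2017, App. B Table "B^{(2),ι,a,b}", first row, d_{C̃}(w,u) = 1 (arXiv:1506.07977v2 p. 76)] -/
theorem blockBNTpt₀'₁_zero_two (v x y t z : Site d) :
    blockBNTpt₀'₁ L ι 0 2 v x y t z = kd v 0 * (kdc v z *
      (L.p⁻¹ * twoDD (z - t) * L.T (.ge 1) (.ge 1) (.eq 1) (y - t) (z - t) 0 *
        L.P (.eq 1) (.ge 0) (.ge 1) (.eq 1) (.ge 1) (stepVec ι) x t z 0)) := rfl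

/-- Row `a = 0, b ≥ 2`, `c = 2` summand. [cite: FitznerVanDerHofstad2017, App. B Table "B^{(2),ι,a,b}", first row, d_{C̃}(w,u) ≥ 2 (arXiv:1506.07977v2 p. 76)] -/
theorem blockBNTpt₀'₂_zero_two (v x y t z : Site d) :
    blockBNTpt₀'₂ L ι 0 2 v x y t z = kd v 0 * (kdc v z *
      (L.S (.ge 1) (.ge 0) (.eq 1) (.ge 1) (x - t) (stepVec ι - t) (-t) (z - t) *
        L.T (.ge 2) (.ge 1) (.ge 1) (z - t) (y - t) 0)) := rfl

/-- Rows `b ≤ 1` of the `c = 1` family vanish. [cite: FitznerVanDerHofstad2017, App. B Table "B^{(2),ι,a,b}", "b ≥ 2" (arXiv:1506.07977v2 p. 76)] -/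
theorem blockBNTpt₀'₁_of_val_le_one (a : Fin 3) {b : Fin 3} (hb : b.val ≤ 1) (v x y t z : Site d) :
    blockBNTpt₀'₁ L ι a b v x y t z = 0 := by
  unfold blockBNTpt₀'₁
  rcases b with ⟨_ | _ | m, hb'⟩
  · rcases a with ⟨_ | _ | _ | n, ha⟩
    · rfl
    · rfl
    · rfl
    · exfalso; omega
  · rcases a with ⟨_ | _ | _ | n, ha⟩
    · rfl
    · rfl
    · rfl
    · exfalso; omega
  · exfalso; change m + 1 + 1 ≤ 1 at hb; omega

/-- Rows `b ≤ 1` of the `c = 2` family vanish. [cite: FitznerVanDerHofstad2017, App. B Table "B^{(2),ι,a,b}", "b ≥ 2" (arXiv:1506.07977v2 p. 76)] -/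
theorem blockBNTpt₀'₂_of_val_le_one (a : Fin 3) {b : Fin 3} (hb : b.val ≤ 1) (v x y t z : Site d) :
    blockBNTpt₀'₂ L ι a b v x y t z = 0 := by
  unfold blockBNTpt₀'₂
  rcases b with ⟨_ | _ | m, hb'⟩
  · rcases a with ⟨_ | _ | _ | n, ha⟩
    · rfl
    · rfl
    · rfl
    · exfalso; omega
  · rcases a with ⟨_ | _ | _ | n, ha⟩
    · rfl
    · rfl
    · rfl
    · exfalso; omega
  · exfalso; change m + 1 + 1 ≤ 1 at hb; omega

end Algebra

/-- **The `c = 1` family in the chain's slot order at a general base point**: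
`blockBNTpt'₁ 𝐋 κ a a' u w t z w' u' = blockBNTpt₀'₁ 𝐋 κ a a' (w−u) (w'−u) (u'−u) (t−u) (z−u)`.
[cite: FitznerVanDerHofstad2017, App. B Table "B^{(2),ι,a,b}(0,v,x,y)" (arXiv:1506.07977v2 p. 76); §5.1 (5.4) (p. 48)] -/
def blockBNTpt'₁ (L : Letters d) (κ : Fin d × Bool) (a a' : Fin 3) (u w t z w' u' : Site d) : ℝ≥0∞ :=
  blockBNTpt₀'₁ L κ a a' (w - u) (w' - u) (u' - u) (t - u) (z - u)

/-- **The `c = 2` family in the chain's slot order at a general base point.**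
[cite: FitznerVanDerHofstad2017, App. B Table "B^{(2),ι,a,b}(0,v,x,y)" (arXiv:1506.07977v2 p. 76); §5.1 (5.4) (p. 48)] -/
def blockBNTpt'₂ (L : Letters d) (κ : Fin d × Bool) (a a' : Fin 3) (u w t z w' u' : Site d) : ℝ≥0∞ :=
  blockBNTpt₀'₂ L κ a a' (w - u) (w' - u) (u' - u) (t - u) (z - u)

section AlgebraPt

variable (L : Letters d) (κ : Fin d × Bool)

/-- `blockBNTpt' = blockBNTpt'₁ + blockBNTpt'₂`. [cite: FitznerVanDerHofstad2017, App. B Table "B^{(2),ι,a,b}(0,v,x,y)" (arXiv:1506.07977v2 p. 76)] -/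
theorem blockBNTpt'_eq_add (a a' : Fin 3) (u w t z w' u' : Site d) :
    blockBNTpt' L κ a a' u w t z w' u' = blockBNTpt'₁ L κ a a' u w t z w' u' + blockBNTpt'₂ L κ a a' u w t z w' u' :=
  blockBNTpt₀'_eq_add L κ a a' _ _ _ _ _

/-- Columns `a' ≤ 1` of the `c = 1` family vanish. [cite: FitznerVanDerHofstad2017, App. B Table "B^{(2),ι,a,b}", "b ≥ 2" (arXiv:1506.07977v2 p. 76)] -/
theorem blockBNTpt'₁_of_val_le_one (a : Fin 3) {a' : Fin 3} (ha' : a'.val ≤ 1) (u w t z w' u' : Site d) :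
    blockBNTpt'₁ L κ a a' u w t z w' u' = 0 :=
  blockBNTpt₀'₁_of_val_le_one L κ a ha' _ _ _ _ _

/-- Columns `a' ≤ 1` of the `c = 2` family vanish. [cite: FitznerVanDerHofstad2017, App. B Table "B^{(2),ι,a,b}", "b ≥ 2" (arXiv:1506.07977v2 p. 76)] -/
theorem blockBNTpt'₂_of_val_le_one (a : Fin 3) {a' : Fin 3} (ha' : a'.val ≤ 1) (u w t z w' u' : Site d) :
    blockBNTpt'₂ L κ a a' u w t z w' u' = 0 :=
  blockBNTpt₀'₂_of_val_le_one L κ a ha' _ _ _ _ _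

end AlgebraPt

/-! ### B. The regular target family and its sum -/

/-- **The TARGET FAMILY of a middle junction with regular classes `(a₀, a′)`** over the variants
`v = (lower-level kind bit, inner class)`: `(false, c) ↦ A'^{κ,a₀,c,*}(u,w,t,z)·A^{c,a′}(t,z,w′,u′)` (`F‴`),
`(true, 0) ↦ δ_{z,t}·A'^{κ,a₀,a′}(u,w,w′,t)·P^{0}(u′−t,u′−t)` (`F′` and the `F″` cut-through),
`(true, 1) ↦ B^{(2)}_pt` summands `c = 1`, `(true, 2) ↦ B^{(2)}_pt` summands `c = 2` (`F″` proper).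
[cite: FitznerVanDerHofstad2017, §5.1 (5.4) (arXiv:1506.07977v2 p. 48); §6.1 (6.4) (p. 58); App. B (p. 76)] -/
def tgtReg (L : Letters d) (κ : Fin d × Bool) (a₀ a' : Fin 3) (u w t z w' u' : Site d) (v : Bool × Fin 3) : ℝ≥0∞ :=
  if v.1 = false then blockAiotaSt' L κ a₀ v.2 u w t z * blockA L v.2 a' t z w' u'
  else ![kd z t * (blockAiota' L κ a₀ a' u w w' t * blockPS L 0 (u' - t) (u' - t)),
    blockBNTpt'₁ L κ a₀ a' u w t z w' u', blockBNTpt'₂ L κ a₀ a' u w t z w' u'] v.2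

section Targets

variable (L : Letters d) (κ : Fin d × Bool) (a₀ a' : Fin 3) (u w t z w' u' : Site d)

/-- [cite: FitznerVanDerHofstad2017, §5.1 (5.4) first summand (arXiv:1506.07977v2 p. 48)] -/
theorem tgtReg_false (c : Fin 3) :
    tgtReg L κ a₀ a' u w t z w' u' (false, c) = blockAiotaSt' L κ a₀ c u w t z * blockA L c a' t z w' u' := rfl

/-- [cite: FitznerVanDerHofstad2017, §5.1 (5.4) second summand (arXiv:1506.07977v2 p. 48)] -/
theorem tgtReg_true_zero :
    tgtReg L κ a₀ a' u w t z w' u' (true, 0) = kd z t * (blockAiota' L κ a₀ a' u w w' t * blockPS L 0 (u' - t) (u' - t)) :=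
  rfl

/-- [cite: FitznerVanDerHofstad2017, §5.1 (5.4) third summand, App. B columns d_{C̃}(w,u) = 1 (arXiv:1506.07977v2 pp. 48, 76)] -/
theorem tgtReg_true_one : tgtReg L κ a₀ a' u w t z w' u' (true, 1) = blockBNTpt'₁ L κ a₀ a' u w t z w' u' := rfl

/-- [cite: FitznerVanDerHofstad2017, §5.1 (5.4) third summand, App. B columns d_{C̃}(w,u) ≥ 2 (arXiv:1506.07977v2 pp. 48, 76)] -/
theorem tgtReg_true_two : tgtReg L κ a₀ a' u w t z w' u' (true, 2) = blockBNTpt'₂ L κ a₀ a' u w t z w' u' := rfl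

/-- The target `(true, 1)` at `(a₀,a′) = (≥2, ≥2)` in literals — the target of
`NobleBoundsNMidEProperTZ.nonempty_jPkg_midE_properTZ_two_two_lit`.
[cite: FitznerVanDerHofstad2017, App. B Table "B^{(2),ι,a,b}", last row, d_{C̃}(w,u) = 1 (arXiv:1506.07977v2 p. 76)] -/
theorem tgtReg_true_one_two_two :
    tgtReg L κ 2 2 u w t z w' u' (true, 1) =
      L.p⁻¹ * twoDD ((z - u) - (t - u)) * L.T (.ge 1) (.ge 1) (.eq 1) ((u' - u) - (t - u)) ((z - u) - (t - u)) 0 *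
        L.P (.eq 1) (.ge 0) (.ge 1) (.eq 1) (.ge 0) (stepVec κ) (w' - u) (t - u) (z - u) (w - u) := rfl

/-- The target `(true, 2)` at `(a₀,a′) = (≥2, ≥2)` in literals — the target of
`NobleBoundsNMidEProper.nonempty_jPkg_midE_proper_two_two_lit`.
[cite: FitznerVanDerHofstad2017, App. B Table "B^{(2),ι,a,b}", last row, d_{C̃}(w,u) ≥ 2 (arXiv:1506.07977v2 p. 76)] -/
theorem tgtReg_true_two_two_two :
    tgtReg L κ 2 2 u w t z w' u' (true, 2) =
      L.B (.ge 1) (.ge 1) ((u' - u) - (t - u)) ((z - u) - (t - u)) *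
        L.P (.eq 1) (.ge 0) (.ge 1) (.ge 2) (.ge 0) (stepVec κ) (w' - u) (t - u) (z - u) (w - u) := rfl

/-- The target `(true, 1)` at `(a₀,a′) = (1, ≥2)` in literals.
[cite: FitznerVanDerHofstad2017, App. B Table "B^{(2),ι,a,b}", row a = 1, b ≥ 2, d_{C̃}(w,u) = 1 (arXiv:1506.07977v2 p. 76)] -/
theorem tgtReg_true_one_one_two :
    tgtReg L κ 1 2 u w t z w' u' (true, 1) =
      L.p⁻¹ * twoDD (w - u) * twoDD ((z - u) - (t - u)) *
          L.T (.ge 1) (.ge 1) (.eq 1) ((u' - u) - (t - u)) ((z - u) - (t - u)) 0 *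
        L.P (.eq 1) (.ge 0) (.ge 1) (.eq 1) (.ge 0) (stepVec κ) (w' - u) (t - u) (z - u) (w - u) := rfl

/-- The target `(true, 2)` at `(a₀,a′) = (1, ≥2)` in literals.
[cite: FitznerVanDerHofstad2017, App. B Table "B^{(2),ι,a,b}", row a = 1, b ≥ 2, d_{C̃}(w,u) ≥ 2 (arXiv:1506.07977v2 p. 76)] -/
theorem tgtReg_true_two_one_two :
    tgtReg L κ 1 2 u w t z w' u' (true, 2) =
      L.p⁻¹ * L.T (.ge 1) (.ge 1) (.ge 2) ((u' - u) - (t - u)) ((z - u) - (t - u)) 0 *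
        L.P (.ge 1) (.ge 0) (.eq 1) (.eq 1) (.ge 0) ((w' - u) - (t - u)) (stepVec κ - (t - u)) (-(t - u))
          ((w - u) - (t - u)) ((z - u) - (t - u)) := rfl

/-- The target `(true, 1)` at `(a₀,a′) = (0, ≥2)` in literals — the target of
`NobleBoundsNMidEProperTZ.nonempty_jPkg_midE_properTZ_zero_two_lit`.
[cite: FitznerVanDerHofstad2017, App. B Table "B^{(2),ι,a,b}", first row, d_{C̃}(w,u) = 1 (arXiv:1506.07977v2 p. 76)] -/
theorem tgtReg_true_one_zero_two :
    tgtReg L κ 0 2 u w t z w' u' (true, 1) = kd (w - u) 0 * (kdc (w - u) (z - u) *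
      (L.p⁻¹ * twoDD ((z - u) - (t - u)) * L.T (.ge 1) (.ge 1) (.eq 1) ((u' - u) - (t - u)) ((z - u) - (t - u)) 0 *
        L.P (.eq 1) (.ge 0) (.ge 1) (.eq 1) (.ge 1) (stepVec κ) (w' - u) (t - u) (z - u) 0)) := rfl

/-- The target `(true, 2)` at `(a₀,a′) = (0, ≥2)` in literals — the target of
`NobleBoundsNMidEProper.nonempty_jPkg_midE_proper_zero_two_lit`.
[cite: FitznerVanDerHofstad2017, App. B Table "B^{(2),ι,a,b}", first row, d_{C̃}(w,u) ≥ 2 (arXiv:1506.07977v2 p. 76)] -/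
theorem tgtReg_true_two_zero_two :
    tgtReg L κ 0 2 u w t z w' u' (true, 2) = kd (w - u) 0 * (kdc (w - u) (z - u) *
      (L.S (.ge 1) (.ge 0) (.eq 1) (.ge 1) ((w' - u) - (t - u)) (stepVec κ - (t - u)) (-(t - u)) ((z - u) - (t - u)) *
        L.T (.ge 2) (.ge 1) (.ge 1) ((z - u) - (t - u)) ((u' - u) - (t - u)) 0)) := rfl

/-- The `F″`-proper targets vanish at exit class `a′ ≤ 1` above (clause (8): those pieces are empty anyway).
[cite: FitznerVanDerHofstad2017, App. B Table "B^{(2),ι,a,b}", "b ≥ 2" (arXiv:1506.07977v2 p. 76); (4.64) (p. 42)] -/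
theorem tgtReg_true_of_val_le_one {a' : Fin 3} (ha' : a'.val ≤ 1) {c : Fin 3} (hc : c ≠ 0) :
    tgtReg L κ a₀ a' u w t z w' u' (true, c) = 0 := by
  rcases c with ⟨_ | _ | _ | n, hc'⟩
  · exact absurd rfl hc
  · exact blockBNTpt'₁_of_val_le_one L κ a₀ ha' u w t z w' u'
  · exact blockBNTpt'₂_of_val_le_one L κ a₀ ha' u w t z w' u'
  · exfalso; omega

/-- **THE SUM IDENTITY**: the targets of a middle junction sum to the three summands of (5.4) — the `F‴` row
sum, the `F′`/cut-through term and the whole `B^{(2)}` piece.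
[cite: FitznerVanDerHofstad2017, §5.1 (5.4) (arXiv:1506.07977v2 p. 48); §6.1 (6.4) "we sum over all cases" (p. 58)] -/
theorem sum_tgtReg_eq :
    ∑ v, tgtReg L κ a₀ a' u w t z w' u' v =
      (∑ c : Fin 3, blockAiotaSt' L κ a₀ c u w t z * blockA L c a' t z w' u')
        + kd z t * (blockAiota' L κ a₀ a' u w w' t * blockPS L 0 (u' - t) (u' - t))
        + blockBNTpt' L κ a₀ a' u w t z w' u' := by
  rw [Fintype.sum_prod_type, Fintype.sum_bool, Fin.sum_univ_three]
  simp only [tgtReg_false, tgtReg_true_zero, tgtReg_true_one, tgtReg_true_two, blockBNTpt'_eq_add]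
  ring

/-- **`hT` for regular class pairs**: the targets sum to at most the pointwise primed middle block, whatever the
extra summand `X`. [cite: FitznerVanDerHofstad2017, §5.1 (5.4) (arXiv:1506.07977v2 p. 48); §6.1 (6.4) (p. 58)] -/
theorem sum_tgtReg_le_blockBFullpt' (X : DirBlockFamilyPt d) :
    ∑ v, tgtReg L κ a₀ a' u w t z w' u' v ≤ blockBFullpt' L X κ a₀ a' u w t z w' u' := by
  rw [sum_tgtReg_eq]
  exact le_self_add

/-- `hT` over any sub-family of variants (e.g. the admissible ones).
[cite: FitznerVanDerHofstad2017, §5.1 (5.4) (arXiv:1506.07977v2 p. 48); §6.1 (6.4) (p. 58)] -/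
theorem sum_filter_tgtReg_le_blockBFullpt' (X : DirBlockFamilyPt d) (P : Bool × Fin 3 → Prop) [DecidablePred P] :
    ∑ v ∈ Finset.univ.filter P, tgtReg L κ a₀ a' u w t z w' u' v ≤ blockBFullpt' L X κ a₀ a' u w t z w' u' :=
  (Finset.sum_le_sum_of_subset (Finset.filter_subset _ _)).trans (sum_tgtReg_le_blockBFullpt' L κ a₀ a' u w t z w' u' X)

/-- `hT` at the FIRST junction: with the start-letter prefix `P^{S,a₀}(u_0,w_0)` on every target.
[cite: FitznerVanDerHofstad2017, §6.1 (6.4)–(6.10) (arXiv:1506.07977v2 pp. 58–59); §5.1 (5.4) (p. 48)] -/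
theorem sum_filter_blockPS_mul_tgtReg_le (X : DirBlockFamilyPt d) (P : Bool × Fin 3 → Prop) [DecidablePred P]
    (S : ℝ≥0∞) :
    ∑ v ∈ Finset.univ.filter P, S * tgtReg L κ a₀ a' u w t z w' u' v ≤ S * blockBFullpt' L X κ a₀ a' u w t z w' u' := by
  rw [← Finset.mul_sum]
  exact mul_le_mul' le_rfl (sum_filter_tgtReg_le_blockBFullpt' L κ a₀ a' u w t z w' u' X P)

end Targets

end Literature.Probability.FitznerVanDerHofstad2017.NobleBlocks

end
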